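import Mathlib
import HarnessLib
import HarnessLib.Audit
import Summits.NavierStokesRegularity.Statement
import Literature.Analysis.FluidPDE.ClassicalSolution
import Literature.Analysis.FluidPDE.LerayHopf
import Literature.Analysis.FluidPDE.SelfSimilar
import Literature.Analysis.FluidPDE.NSWave0
import Summits.NavierStokesRegularity.NavierStokesRegularity.Theorems.AdiabaticEddyClayUniqueness
import HarnessLib.Audit.Status.Attr

/-!
Route: CirculationRelay

# Route CirculationRelay — NEGATIVE side — a lossless octahedral (O_h) circulation relay as the
SOURCE of a Type-I λ-DSS profile: Kelvin the battery, one fixed Reynolds number the price, ESS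
forces an ancient fixed point

It suffices to show X = X_Oh ∧ X5b. X_Oh (OhBlowupExists): for some ν > 0 there is a rapidly
decaying datum u₀ that is OCTAHEDRALLY EQUIVARIANT — u₀(g x) = g u₀(x) for every linear isometry g
of ℝ³ permuting the signed coordinate axes (the 48 signed-permutation isometries = the full
octahedral group O_h = B₃, Kida's high-symmetry class) — whose finite-energy (Leray–Hopf) classical
solution has finite maximal lifespan T (no classical extension past T). X5b (ClayUniqueness, shared
verbatim with route Blowup, stmt-NavierStokesRegularity-0153): Clay-class uniqueness. Realises card
circulation-relay-machine: X_Oh is the output of a LOSSLESS CIRCULATION RELAY — an O_h-equivariant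
Type-I λ-DSS ancient profile (crux OhRelayProfileExists = the fixed point of the renormalised
one-stage relay map, λ = the aspect ratio A of the flattening stage; Tsai's Type-I DSS Liouville
conjecture negated IN THE O_h SECTOR) truncated O_h-symmetrically to a Schwartz datum keeping the
singularity at the apex (crux OhTruncationBridge). The kill switch OhTypeIDssLiouville (=
¬OhRelayProfileExists, proved equivalent in Sketch.lean) and the typed necessary condition
CirculationFloor (the Kelvin-battery floor every stage and every profile must meet) are filed with
it.
Lean: `(∃ ν : ℝ, 0 < ν ∧ ∃ T : ℝ, 0 < T ∧ ∃ (u : ℝ → EuclideanSpace ℝ (Fin 3) → EuclideanSpace ℝ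
(Fin 3)) (p : ℝ → EuclideanSpace ℝ (Fin 3) → ℝ),
Literature.Analysis.FluidPDE.IsMaximalSmoothSolution ν 0 u p T ∧
Literature.Analysis.FluidPDE.IsLerayHopfOn T ν 0 (u 0) u ∧
Literature.Analysis.FluidPDE.HasRapidSpatialDecay (u 0) ∧ (∀ g : EuclideanSpace ℝ (Fin 3) ≃ₗᵢ[ℝ]
EuclideanSpace ℝ (Fin 3), (∀ i : Fin 3, ∃ j : Fin 3, g (EuclideanSpace.single i 1) =
EuclideanSpace.single j 1 ∨ g (EuclideanSpace.single i 1) = -EuclideanSpace.single j 1) → ∀ x, u 0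
(g x) = g (u 0 x))) ∧ (∀ ν : ℝ, 0 < ν → ∀ (u₀ : EuclideanSpace ℝ (Fin 3) → EuclideanSpace ℝ (Fin
3)), Literature.Analysis.FluidPDE.HasRapidSpatialDecay u₀ → ∀ (u v : ℝ → EuclideanSpace ℝ (Fin 3) →
EuclideanSpace ℝ (Fin 3)) (p q : ℝ → EuclideanSpace ℝ (Fin 3) → ℝ) (T : ℝ), 0 < T →
Literature.Analysis.FluidPDE.IsSmoothOnHalfSpace u →
Literature.Analysis.FluidPDE.IsSmoothOnHalfSpace p →
Literature.Analysis.FluidPDE.IsNavierStokesSolution ν 0 u₀ u p →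
Literature.Analysis.FluidPDE.HasBoundedEnergy u →
Literature.Analysis.FluidPDE.IsClassicalNSSolutionOn (Set.Ico 0 T) ν 0 v q →
Literature.Analysis.FluidPDE.IsLerayHopfOn T ν 0 u₀ v → v 0 = u₀ → ∀ t ∈ Set.Ico 0 T, u t = v t)`

## Assembly
DECIDING THEOREM (rev 3, sorry-free, in the route file): `closes : OhRelayProfileExists →
OhTruncationBridge → ClayUniqueness → ¬NavierStokesRegularity`. The bridge applied to the profile
gives an O_h-symmetric maximal smooth Leray–Hopf solution (u,p) with finite lifespan T from a
rapidly decaying datum (dropping the equivariance clause = X5a); Clay (A) applied to the datum u 0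
(smooth and divergence-free as a slice of a classical solution) gives a global jointly smooth
bounded-energy (u′,p′); ClayUniqueness (X5b) identifies u′ = u on [0,T); the wave-0 system plus
joint smoothness is fieldwise a classical solution on Ici 0, and its restriction to Ico 0 (T+1)
extends u past T — contradiction with maximality. This is the argument of the accepted glue
Literature.NS.blowup_assembly (stmt-NavierStokesRegularity-0151, (X5a ∧ X5b) → ¬A) INLINED, so that
neither a Theorems file nor Literature.Analysis.FluidPDE.NSLerayHopf enters the import cone. The
optional item Assembly (stmt-1539) is the same implication as a Prop and closes by `fun hP hB hU =>
closes hP hB hU`. The target RelayThesis = OhBlowupExists ∧ ClayUniqueness follows from cruxes 2, 3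
and the shared X5b. The unsymmetric chain through Tsai's wall (profile ⇒
¬TypeIDSSLiouvilleConjecture ⇒ X5a by the bridge stmt-0901 ⇒ ¬A) belongs to route DssFarFieldSlaving
and was detached from this route at rev 3 (RANKED CRUXES, last paragraph).

Rationale: WHY THIS LINE. Change the currency of a cascade machine from energy to CIRCULATION: Kelvin's theorem
with viscosity, dΓ/dt = −ν∮(∇×ω)·dl, is a lossless battery with no efficiency requirement (a
structure of scale ℓ carrying Γ needs energy only ~Γ²ℓ, which decreases down the cascade, so the
premature-leakage obstruction of the dyadic/averaged energy machines — Tao2016AveragedNS §1.3,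
barrier entries DyadicCascadeRegularity/TruncatedDyadicBlowup — is irrelevant), while viscosity
imposes a circulation QUANTUM: blow-up forces loops of vanishing diameter with |∮u·dl| ≥ c₀ν
(CirculationFloor; contrapositive of the in-tree, proved cheskidov_shvydkoy_dyadic_holds,
CheskidovShvydkoy2010 Lemma 3.2, Morrey folklore GigaMiyakawa1989); hence every SPLITTING cascade —
BrennerHormozPumir2016 p. 8 eq. (17),(19): Γ_(n+1) = C(b_n/a_n)Γ_n, “the sheet breaks up into ≈ a/λ
pieces each carrying a fraction λ/a of the circulation”; MckeownEtAl2020: ≈ 25 % of circulation per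
secondary filament — has local Reynolds number θⁿΓ₀/ν → 0 and dies after ≈ log(Γ₀/c₀ν)/log(1/θ)
generations (turbulence, not a singularity), and an NS cascade singularity must be a LOSSLESS
single-roll-up relay operating at ONE fixed Re = Γ/ν (Γ is scale-invariant, so the viscous survival
condition h² ≫ ντ_n is the same pure number Re_relay = (ℓ/h)²·log A at every stage). New at route
level (not on the card): an EXACT finite-energy relay u(τ) = A·u(0)(A·) from a Schwartz datum would
be exactly backward-DSS on [τ,T) with ‖u(t_k)‖_L³ constant along the stage times t_k ↑ T,
contradicting seregin_L3_blowup / ess_endpoint (barrier CriticalNormBlowupNecessity) — so the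
relay's fixed point must live in the infinite-energy ANCIENT class (Type-I λ-DSS ancient mild
solution; its C/|x| tail is the L³-divergent debris of all earlier stages) and finite energy is
restored by truncation, which is exactly the Tsai-profile + bridge format of Blowup crux #5
(stmt-0155) and route DssFarFieldSlaving (stmt-0901), now in a definite SECTOR. Habitat O_h
(Kida1985, BoratavPelz1994, Pelz1997, Pelz2001: the vortex dodecapole, three mutually orthogonal
antiparallel pairs, each both hammer and anvil): Type-I DSS is illegal under any continuous
stabiliser (barrier AxisymmetricTypeIExclusion; KNSS2009 Thms 5.1–5.3), so a finite point group is
forced, and the maximal one pays twice — rotated DSS with phase R ∈ O_h collapses to plain λ-DSS on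
equivariant fields (R acts trivially), and the vector (T₁u) and pseudovector (T₁g) representations
contain no O_h-invariants, so the linearised period map in the equivariant sector has NO
translation/rotation neutral modes: only the blow-up time is modulated in the truncation step, the
cleanest Floquet problem available. Imported: classical vortex dynamics for the stage (strain
flattening, Kelvin–Helmholtz/Kaden single-spiral roll-up collecting the whole sheet circulation θ_Γ
= 1, Moore–Saffman, elliptical instability Kerswell2002); representation theory of B₃ (isotypic
bookkeeping, cf. ElgindiJeong2021's octahedral Euler blow-up in the Weyl chamber as the inviscid
adversary); and, from numerical relativity, the construction of a discretely self-similar solution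
as a periodic-in-log-time nonlinear eigenvalue problem for (profile, period) (Gundlach1997, Choptuik
echoing) as the template for the certified one-stage/fixed-point computation (informal crux
OneLosslessStage, filed after open). Versus the negatives index (empty) and prior routes: Blowup
files H1 generically and DssFarFieldSlaving the bridge while explicitly leaving the SOURCE of H1
outside; this route is a source with its own mechanism, sector, kill switch and necessary condition.

RANKED CRUXES. Ranks: 2 = the relay fixed point (hardest, most informative), 3 = symmetric
truncation, 4 = reserved for the informal computational crux OneLosslessStage (card R1; filed after
open with --informal, it is layer-2 child C1 of crux 2 until typed), 5 = the kill switch. Supports: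
X5b (verbatim re-ask of stmt-0153), the circulation floor (provable now) and the optional Assembly
Prop; the Tsai-wall link and the re-ask of the unsymmetric bridge stmt-0901 were detached at rev 3
(last paragraph of this section).
#0 RelayThesis (target) — X_Oh ∧ X5b — an octahedrally equivariant rapidly decaying datum whose
Leray–Hopf classical solution has finite maximal lifespan, and Clay-class uniqueness (stmt-0153
verbatim as second conjunct). Definitionally OhBlowupExists ∧ ClayUniqueness (rfl in Sketch.lean).
(why it might fail: the O_h sector may simply be empty for Type-I DSS (crux OhTypeIDssLiouville
true): every octahedral/antiparallel DNS to date ends in sheet thinning, depletion and reconnection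
through the mirror planes, i.e. circulation LOSS (BoratavPelz1994, HouLi2008, GrafkeEtAl2008).)
[Pelz2001, BoratavPelz1994, HouLi2008, Tsai2018, Fefferman2000]
#2 OhRelayProfileExists (crux) — card (R2), the relay's stage-map fixed point in the in-tree
language: there are λ > 1 and a NONTRIVIAL ancient mild solution u of NS (ν = 1) on ℝ³×(−∞,0) with
measurable slices, λ-discretely self-similar (nsRescale λ u = u), with a Type-I bound |u(t,x)| ≤
C₀/(|x|+√−t), and O_h-EQUIVARIANT: u(t, g x) = g u(t, x) for all t < 0, all x and every linear
isometry g permuting the signed coordinate axes. λ = A (or A^k) is the relay's aspect ratio; one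
period = one stage (tube → sheet → single spiral → tube at scale 1/A, all three pairs
simultaneously); the C₀/|x| tail is the debris of the earlier stages. Implies
¬TypeIDSSLiouvilleConjecture (a 3-line unfolding: apply the conjunct TypeIDSSLiouville λ of the wall
to the profile) hence serves Blowup #5 / DssFarFieldSlaving H1 (stmt-0155) as their first concrete
source sector; that formal link is kept OUT of this route's file since rev 3 (import-cone hygiene)
and belongs with DssFarFieldSlaving. [difficulty: open-problem] (why it might fail: Tsai's Liouville
side may hold (λ≈1 removed under this very bound, ChaeWolf2017RemovingDSS Thm 1.3; SS profiles
vanish, Tsai1998); and O_h puts 9 mirror planes with ω ∥ n through the singular point, exactly where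
antiparallel sheets annihilate — every symmetric DNS so far loses circulation there.) [Tsai2018,
BradshawTsai2017CPDE, ChaeWolf2017RemovingDSS, BrennerHormozPumir2016, Pelz1997, Pelz2001, Kida1985,
MckeownEtAl2020]
#3 OhTruncationBridge (crux) — card (R3) in symmetric form: OhRelayProfileExists → OhBlowupExists.
Given the O_h profile u_*, truncate O_h-symmetrically (Bogovskiĭ-corrected cut-off at radius R,
mollified tail) to a Schwartz divergence-free equivariant datum; equivariance propagates by
uniqueness of classical solutions, so the singularity stays at the apex x = 0 (where u = ∇u = 0 for
all t by Schur); in Leray variables the profile is an s-periodic orbit and the tuning is a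
finite-codimension stable-manifold problem for its monodromy operator restricted to the
O_h-invariant isotypic component, which contains neither the three unstable translation multipliers
e^(P/2) (T₁u) nor the three neutral rotation multipliers (T₁g): the only modulation parameter is the
blow-up time. Weaker than its unsymmetric twin DssTruncationBridge (stmt-0901 of route
DssFarFieldSlaving) composed with the Tsai-wall link EXCEPT for the equivariance of the output
datum; the deciding theorem `closes` uses the symmetric chain only. [deps: OhRelayProfileExists]
[difficulty: XL] (why it might fail: with the symmetry modes gone, the equivariant monodromy
operator of a large-C₀ orbit may still carry infinitely many unstable multipliers (essential
spectrum from the L^∞ far field once C₀/(4ν) > gap ½); then only a hyperbolicity-conditional bridge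
survives (DssFarFieldSlaving #3).) [JiaSverak2014, BradshawTsai2019, ChaeWolf2018, Tsai2018,
ElgindiJeong2021, stmt-NavierStokesRegularity-0901]
#5 OhTypeIDssLiouville (crux) — the KILL SWITCH, Tsai's Type-I λ-DSS Liouville statement restricted
to the O_h sector: for every λ > 1, every O_h-equivariant ancient mild solution (ν = 1, measurable
slices) that is λ-DSS with a Type-I bound vanishes a.e. on every slice t < 0. Logically ↔
¬OhRelayProfileExists (ohLiouville_iff_not_profile in Sketch.lean); filed with a rank because it is
the cheap decisive refutation of the line and a NEW sector Liouville problem with extra structure no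
tool on file uses: a finite (not continuous) stabiliser, u(t,0) = 0 and ∇u(t,0) = 0 (flat apex), ω
normal to each of the 9 mirror planes, zero helicity, and on each mirror the normal vorticity obeys
a conservative 2-D advection–diffusion law — a scalar, maximum-principle-friendly reduction through
the singular point. If proved it is negative knowledge for every profile hunter (quarter-turn RDSS,
dynamo cards): leave O_h. [difficulty: open-problem] (why it might fail: it is ¬(crux 2): false
exactly if the relay fixed point exists; KNSS2009 Thms 5.1–5.3 / SereginSverak2009 need a CONTINUOUS
symmetry and ChaeWolf2017RemovingDSS only λ near 1, so a proof must exploit the mirror-plane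
structure — untested.) [KNSS2009, SereginSverak2009, ChaeWolf2017RemovingDSS, Tsai2018,
ElgindiJeong2021, Pelz2001]
#9 ClayUniqueness (support) — X5b, stmt-NavierStokesRegularity-0153 VERBATIM (shared with Blowup and
DssFarFieldSlaving): a Clay-class solution (jointly smooth, bounded energy, nothing else) from a
rapidly decaying datum coincides on [0,T) with the Leray–Hopf classical solution; closes via
stmt-0728 once Tao's unconditional uniqueness fact is vendored. [difficulty: L] [Tao2011,
Fefferman2000]
#9 CirculationFloor (support) — card (R4), the KELVIN-BATTERY FLOOR in loop language, provable now:
there is an absolute c₀ > 0 such that if a finite-energy classical solution from a rapidly decaying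
datum on [0,T) has no smooth extension past T, then for every δ > 0 some slice t < T and some planar
circle of radius r ≤ δ (centre c, orthonormal frame e₁,e₂) carry circulation |∮ u(t)·dl| ≥ c₀ν.
Proof route (contrapositive): circle circulation = disc flux of ω (Stokes, u(t) smooth); slicing a
ball by planes ⊥ n gives |∫_(B_ρ(x)) ω·n| ≤ 2ρ·c₀ν for ρ ≤ δ, all x, n, t; the heat-kernel (radially
decreasing kernel = superposition of balls; the ρ > δ part is bounded by the energy through ∫_(B_ρ)
ω·n = ∮_(∂B_ρ)(ν_out×u)·n and dies super-exponentially) characterisation of negative Besov norms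
gives sup_t ‖Δ_q ω(t)‖_∞ ≲ c₀ν 2^(2q), Biot–Savart sup_t 2^(−q)‖Δ_q u(t)‖_∞ ≲ C c₀ν for large q, so
for c₀ small the in-tree PROVED criterion cheskidov_shvydkoy_dyadic_holds (CheskidovShvydkoy2010
Lemma 3.2) yields a classical representative on (0,T], and the in-tree local theory
(leray_local_regular_H1_holds / leray_continuation_H1_holds) extends past T. Consequences used by
the line: every relay stage and the profile of crux 2 must carry a loop with |Γ| ≥ c₀ (ν = 1) at
every scale (by DSS, at one scale); splitting cascades with fixed θ < 1 terminate. The retired card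
circulation-floor (Morrey/unsigned form, GKT corner) is re-homed here in its signed loop form, as
its triage note recommends. [difficulty: M] [CheskidovShvydkoy2010, GigaMiyakawa1989,
BrennerHormozPumir2016, MckeownEtAl2020]
Detached at rev 3 (route-repair; import-cone hygiene, needs-fact: none): OhProfileGivesTsaiWitness
(stmt-NavierStokesRegularity-1537: OhRelayProfileExists → ¬TypeIDSSLiouvilleConjecture, a 3-line
unfolding, documentation value only) and the verbatim re-ask of DssTruncationBridge
(stmt-NavierStokesRegularity-0901, still wanted by route DssFarFieldSlaving). They were the only
decls naming Literature.Analysis.FluidPDE.SelfSimilarLiouville, through which 8 unproved named facts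
no crux uses (TypeIDSSLiouvilleConjecture, LiouvilleConjectureNS, AxisymmetricSwirlRegularity,
AxisymmetricLiouvilleBoundedSwirl, chae_wolf_dss_existence, bradshawTsai2019_dss_existence,
chaeWolf2018_dss_existence, and IsVorticitySolutionOn.exists_pressure via AxisymmetricEuler →
Vorticity) rode into the import cone and kept the route unstaffed; neither is on the deciding chain
OhRelayProfileExists → OhTruncationBridge → ClayUniqueness → ¬A. Route imports are now
ClassicalSolution, LerayHopf, SelfSimilar, NSWave0 (all crux vocabulary — IsAncientMildSolution,
IsDiscretelySelfSimilar, HasTypeIDecay, nsRescale — lives in SelfSimilar.lean); the residual cone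
debt is the Clay variants B/C/D of NSWave0, imported by the Statement itself and shared by every
route of the summit.

TWO-LAYER PLAN. Foreseen glued splits (nothing filed now; k ≤ 3, depth 1). OhRelayProfileExists ⇐ C1
→ C2 → C3 → OhRelayProfileExists with C1 = OneLosslessStage in Newton–Kantorovich form (a
computer-verified approximate O_h DSS orbit: renormalised stage map 𝓡 = S_A⁻¹ ∘ Φ_τ with ‖𝓡(U₀) −
U₀‖ small against the certified inverse bound of I − D𝓡(U₀) in an equivariant Gaussian-weighted
vorticity space × weighted-sup tail, period 2·log λ as an unknown à la Gundlach1997 / ChenHou2025),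
C2 = equivariant Floquet/inverse bound for the linearised period map, C3 = fixed-point upgrade
(approximate ⇒ exact ancient Type-I orbit, Type-I tail from the outward drift). OhTruncationBridge ⇐
B1 → B2 → B3 with B1 = GaussianFloquetTheory in the O_h-invariant isotypic component (shared in
spirit with DssFarFieldSlaving #4), B2 = symmetric stable manifold (modulation in T only), B3 =
Schwartz O_h realisation of the tuned datum. OhTypeIDssLiouville ⇐ D1 → D2 with D1 = mirror-plane
Liouville (the normal vorticity ω_n on each of the 9 mirrors solves ∂_s W + div_P(V W) = Δ_P W +
∂_n²ω restricted, s-periodic with Type-I decay in similarity variables ⇒ W ≡ 0) and D2 = (ω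
vanishing on all mirrors + O_h Type-I DSS ⇒ u ≡ 0).

KILL CRITERIA. OhTypeIDssLiouville PROVED (crux 5; or TypeIDSSLiouvilleConjecture proved, a
fortiori) ⇒ close `refuted:OhRelayProfileExists` and record the sector Liouville theorem as negative
knowledge for all profile hunters (quarter-turn-rdss-funnel, corkscrew/dynamo cards: leave O_h);
CirculationFloor survives as a Literature-grade lemma. A per-stage circulation-LOSS floor (the
informal negation of OneLosslessStage: loss ≥ η₀ > 0 uniformly in Re for reflection-symmetric
antiparallel sheet approach, i.e. annihilation number beats roll-up number at every Re) ⇒ close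
`exhausted` with census (no lossless relay; all tube scenarios pushed to no-sheet collapse, cf. the
refuted card antiparallel-collapse-critical-reynolds). OhTruncationBridge refuted (an O_h profile
all of whose symmetric Schwartz truncations are global) ⇒ pivot by restating crux 3 in
hyperbolicity-conditional form (DssFarFieldSlaving #3 with the equivariant hypothesis). NoBlowup
(stmt-NavierStokesRegularity-0054) proved ⇒ moot, close superseded. X5b refuted (stmt-0154) ⇒ the
negative side loses its assembly (shared fate with Blowup/DssFarFieldSlaving): close unless a
replacement selection principle lands.

NOT DECOMPOSED YET. The stage itself — flattening time ε⁻¹·log A with ε ~ Γ/ℓ², KH growth σ ≈ ΔU·k/2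
with σ ~ Γ/(hℓ), Kaden single-spiral roll-up (θ_Γ = 1 inviscidly), the annihilation number through
the mirror quarter-planes (the only loss channel for reflection-symmetric configurations:
dΓ_quarter-plane/dt = ν∫∂_n ω_tangential along the mirror line) — stays inside the informal crux
OneLosslessStage until one validated computation fixes Re, A, the stage time and the norm; whether
one DSS period is one stage (λ = A) or k stages (λ = A^k); the function space of the equivariant
Floquet theory (Gaussian-weighted vorticity core × weighted-sup tail, as in DssFarFieldSlaving);
lower-symmetry fallback habitats (T_d, D_4h, D_2d = Kerr/quarter-turn classes) if crux 5 empties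
O_h; the Type-I rate clause of the output (DssFarFieldSlaving's DssTruncationBridgeTypeI analogue) —
all layer-2 or later.

CHEAPEST FALSIFIER. ONE moderate-resolution NS run (kit; BoratavPelz1994/Pelz2001 dodecapole datum,
1/48 fundamental domain) at the largest feasible Γ/ν, instrumented for (i) circulation through each
mirror quarter-plane ∩ B_ℓ versus time across one collapse stage and (ii) whether the flattened
sheets roll up into ONE spiral each or tear into N ≥ 2 filaments: monotone O(1) fractional loss per
stage at all accessible Re, or tearing (θ_Γ ≈ 1/N, as BrennerHormozPumir2016 eq. (17) and
MckeownEtAl2020's 25 % predict for unsymmetric pairs), retires the relay and leaves only crux 5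
worth staffing. Honest prior: published Kida–Pelz runs (BoratavPelz1994 viscous saturation;
HouLi2008, GrafkeEtAl2008: at most doubly exponential growth, sheets thinning without roll-up) lean
AGAINST losslessness, but none measured mirror circulation — the deciding number. Lookups done: no
printed Liouville/regularity theorem covers finite-group-symmetric Type-I DSS (KNSS2009 5.1–5.3
continuous symmetries; SereginSverak2009 axisymmetric; ChaeWolf2017RemovingDSS Thm 1.3 λ near 1), so
crux 2 is not dead on arrival; by hand, the trivial representation of O_h has multiplicity 0 in T₁u
and T₁g (crux 3's no-neutral-mode claim).

NUMBERS. |O_h| = 48 = signed permutation matrices = O(3) ∩ GL₃(ℤ); fundamental domain 1/48 of space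
(Weyl chamber of B₃, dihedral angles π/2, π/3, π/4). RDSS phase R ∈ O_h ⇒ plain λ-DSS on equivariant
fields; R ∉ O_h impossible (O_h is self-normalising among finite subgroups, maximality).
BrennerHormozPumir2016: Γ_(n+1) = C(b_n/a_n)Γ_n with C ≈ 8 (eq. 19), fixed point x_∞ =
(1+2β)/(2(1−2α))·ln(C/π) existing iff α > 1/2 and then UNSTABLE (eq. 22–23), “whether the
instability can really iterate … the most suspect step” (p. 8). MckeownEtAl2020: x_Γ ≈ 0.25 per
generation ⇒ n* ≈ log(Re_Γ)/log 4 generations before viscous cut-off. Relay bookkeeping (card):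
stage time τ_n ≈ (ℓ_n²/Γ)[log A + (h/ℓ)log(1/δ_seed)], ℓ_(n+1) = ℓ_n/A, Στ_n < ∞ geometric, velocity
Γ/ℓ_n ~ (T−t)^(−1/2) (Type I), survival Re ≫ Re_relay = (ℓ/h)²·log A identical at every stage.
ChaeWolf2017RemovingDSS Thm 1.3: for each C_* a λ_*(C_*) > 1 with no smooth Type-I λ-DSS for 1 < λ <
λ_*; the relay has λ = A ≥ 2. Exact finite-energy relay impossible: ‖u(t_k)‖_L³ = ‖u₀‖_L³ along t_k
↑ T versus seregin_L3_blowup (‖u(t)‖_L³ → ∞); a Type-I DSS blow-up has ‖u(t)‖³_L³ ~ log(1/(T−t)) —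
one L³ quantum of debris per stage. Leray operator in similarity variables: spectrum −½ − k/2 on
L²(e^(−|y|²/4)), gap ½; transport 𝓛-bounded with constant C₀/4 (DssFarFieldSlaving).
Cheskidov–Shvydkoy: limsup_q sup_t 2^(−q)‖Δ_q u‖_∞ < cν ⇒ regular (in-tree constant c of
cheskidov_shvydkoy_dyadic). Circulation has the dimension of ν: the floor is |Γ| ≥ c₀ν, scale-free.

DEFINITION REQUESTS. (1) `IsOctahedralIsometry (g : EuclideanSpace ℝ (Fin 3) ≃ₗᵢ[ℝ] EuclideanSpace ℝ
(Fin 3)) : Prop := ∀ i, ∃ j, g (EuclideanSpace.single i 1) = ± EuclideanSpace.single j 1` and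
`IsOhEquivariant (v : ℝ³ → ℝ³) : Prop := ∀ g, IsOctahedralIsometry g → ∀ x, v (g x) = g (v x)`
(topic Literature/Analysis/FluidPDE next to IsAxisymmetric, or
Summits/NavierStokesRegularity/NavierStokesRegularity/Theorems) — inlined verbatim in every
statement above until they land; a later `route edit --restate` can shorten the decls without
changing meaning. (2) `loopCirculation (v : ℝ³ → ℝ³) (γ : ℝ → ℝ³) : ℝ := ∫ θ in 0..2π, ⟪v (γ θ),
deriv γ θ⟫` for C¹ loops (Literature/Analysis/FluidPDE), to restate CirculationFloor over general
loops and to type the stage's quarter-plane circulation ledger. (3) No cite items needed now: the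
facts used (cheskidov_shvydkoy_dyadic, blowup_assembly — the latter's argument inlined in `closes`)
are PROVED in the tree; Tsai's wall is not named in this file (rev 3).

Novelty: Searches (2026-08-15): `lit frontier NavierStokesRegularity --since 2020` (30 newest descendants:
forward self-similar 2-D arXiv:2601.03161/2603.12497/2601.03833, sharp non-uniqueness ×6,
ε-regularity — nothing on backward DSS constructions or finite-symmetry sectors); `lit bridges
NavierStokesRegularity --cross any` (30 rows: Abel volume, convex-integration surveys,
Lemarié-Rieusset — no vortex-relay/DSS-sector work); `lit search --source crossref "vortex
dodecapole collapse Pelz"` → Pelz1997 (doi:10.1103/physreve.55.1617, locally self-similar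
finite-time collapse in the high-symmetry FILAMENT model), Kimura2009
(doi:10.1007/s00162-009-0175-9); `--source crossref "octahedral symmetry self-similar
Navier-Stokes"` → Xue2015 (doi:10.1088/0951-7715/28/10/3695, forward DSS), Tsai GSM 192 ch. 8;
`--source zbmath` same queries 0–2 hits; `--source crossref "Kida high-symmetry flow singularity …"`
→ Moffatt–Kimura JFM 2019/2020 only; arXiv API rate-limited (HTTP 429) and local searchd unavailable
(exit 75) at four attempts 10:40–11:05Z — grader please re-run `lit search --hybrid "Kida Pelz high
symmetry Navier-Stokes singularity circulation"`; `lit galaxy search "discretely self-similar"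
--star all` (25 rows: Lemarié-Rieusset's DSS chapter, the Choptuik/Gundlach critical-collapse DSS
literature — imported here as the numerical template Gundlach1997 —, a Bradshaw abstract; no NS
relay), `"vortex dodecapole" --star all` 0, `"high-symmetric flow" --star pdf` 1 irrelevant,
`"Kida-Pelz" -  [refs: 10.1103/physreve.55.1617, 10.1007/s00162-009-0175-9, 10.1088/0951-7715/28/10/3695, 10.1103/physrevfluids.1.084503`, 2601.03161, doi:10.1103/physreve.55.1617, doi:10.1007/s00162-009-0175-9, doi:10.1088/0951-7715/28/10/3695, doi:10.1103/physrevfluids.1.084503, Pelz1997, Kimura2009, Gundlach1997, BrennerHormozPumir2016, MckeownEtAl2020, Kida1985, BoratavPelz1994, Pelz2001, HouLi2008, GrafkeEtAl2008, ]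

Barriers (technique_class: blowup-construction, dss, vortex-relay, equivariant): - technique_class: blowup-construction, dss, vortex-relay, equivariant
- Literature.Barriers.NavierStokesRegularity.AxisymmetricTypeIExclusion: evaded by habitat and the
reason for it — a nontrivial O_h-equivariant field has finite stabiliser, is never axisymmetric, so
SereginSverak2009 Thm 3.1 / in-tree knss_no_axisymmetric_typeI (and KNSS2009 Thms 5.1–5.3, all
continuous-symmetry reductions) do not apply; Type-I DSS is legal exactly here.
- Literature.Barriers.NavierStokesRegularity.LeraySelfSimilarBlowupExclusion: evaded by discreteness
— the profile is λ-DSS with λ = A ≥ 2 (an s-periodic orbit, not a fixed point of the similarity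
flow), outside necas_ruzicka_sverak / tsai_selfsimilar / tsai_selfsimilar_local_energy;
ChaeWolf2017RemovingDSS Thm 1.3 constrains only λ < λ_*(C₀), recorded in Numbers.
- Literature.Barriers.NavierStokesRegularity.CriticalNormBlowupNecessity: respected AND load-bearing
— it is why the relay's fixed point is placed in the infinite-energy ancient class (an exact
finite-energy relay would keep ‖u(t_k)‖_L³ bounded along t_k ↑ T, contradicting
seregin_L3_blowup/ess_endpoint); the truncated output has ‖u(t)‖³_L³ ~ log(1/(T−t)) → ∞ with weak-L³
bounded, the Type-I scenario the entry leaves open (tao_L3_blowup_rate respected: log ≫ triple log).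
- Literature.Barriers.NavierStokesRegularity.SingularSetDimensionBound: respected — one singular
point, the apex (0,T), fixed by the symmetry.
- Literature.Barriers.NavierStokesRegularity.DyadicCascadeRegularity:

History (route lifecycle, newest last):
- 2026-08-15T10:59:17Z · rev 1: dropped stmt-NavierStokesRegularity-1644 — drop accidental duplicate of OneLosslessStage (stmt-NavierStokesRegularity-1605 is the intended item; 1644 was created by a repeated workitem add) (planner-plancard-NavierStokesRegularity-Navie-0faa9fe5-0)
- 2026-08-15T16:20:06Z · rev 3: dropped DssTruncationBridge, OhProfileGivesTsaiWitness — route-repair rev 3: deciding theorem closes : OhRelayProfileExists → OhTruncationBridge → ClayUniqueness → ¬NavierStokesRegularity (blowup_assembly argument inl (planner-rbadge-NavierStokesRegularity-Circulat-6a16d06a-g2-0)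

sub-problem: NavierStokesRegularity · status: done · opened planner-plancard-NavierStokesRegularity-Navie-0faa9fe5-0 2026-08-15T10:57:12Z · rev 3 · ledger route-NavierStokesRegularity-CirculationRelay
GENERATED by the gate from the ledger (D-0016/17). Provers cite these decls: `theorem foo : Summit.NavierStokesRegularity.NavierStokesRegularity.Theses.CirculationRelay.<Decl> := …` in Summits/NavierStokesRegularity/NavierStokesRegularity/Theorems/<Name>.lean.
-/

namespace Summit.NavierStokesRegularity.NavierStokesRegularity.Theses.CirculationRelay

open scoped BigOperators Topology Manifold Classical MeasureTheory ProbabilityTheory Matrix InnerProductSpace ComplexConjugate ContinuousMap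
open Filter Set Function TopologicalSpace MeasureTheory

attribute [summit_statement] _root_.NavierStokesRegularity

open Literature.NS

/-- item stmt-NavierStokesRegularity-1533 · target · rank 0 · open · by planner
why it might fail: the O_h sector may simply be empty for Type-I DSS (crux OhTypeIDssLiouville true): every octahedral/antiparallel DNS to date ends in sheet thinning, depletion and reconnection through the mirror planes, i.e. circulation LOSS (BoratavPelz1994, HouLi2008, GrafkeEtAl2008).
sources: Pelz2001, BoratavPelz1994, HouLi2008, Tsai2018, Fefferman2000
[target] X_Oh ∧ X5b — an octahedrally equivariant rapidly decaying datum whose Leray–Hopf classical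
solution has finite maximal lifespan, and Clay-class uniqueness (stmt-0153 verbatim as second
conjunct). Definitionally OhBlowupExists ∧ ClayUniqueness (rfl in Sketch.lean). -/
@[route_item "route-NavierStokesRegularity-CirculationRelay"]
def RelayThesis : Prop :=
  (∃ ν : ℝ, 0 < ν ∧ ∃ T : ℝ, 0 < T ∧ ∃ (u : ℝ → EuclideanSpace ℝ (Fin 3) → EuclideanSpace ℝ (Fin 3)) (p : ℝ → EuclideanSpace ℝ (Fin 3) → ℝ), Literature.Analysis.FluidPDE.IsMaximalSmoothSolution ν 0 u p T ∧ Literature.Analysis.FluidPDE.IsLerayHopfOn T ν 0 (u 0) u ∧ Literature.Analysis.FluidPDE.HasRapidSpatialDecay (u 0) ∧ (∀ g : EuclideanSpace ℝ (Fin 3) ≃ₗᵢ[ℝ] EuclideanSpace ℝ (Fin 3), (∀ i : Fin 3, ∃ j : Fin 3, g (EuclideanSpace.single i 1) = EuclideanSpace.single j 1 ∨ g (EuclideanSpace.single i 1) = -EuclideanSpace.single j 1) → ∀ x, u 0 (g x) = g (u 0 x))) ∧ (∀ ν : ℝ, 0 < ν → ∀ (u₀ : EuclideanSpace ℝ (Fin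 3) → EuclideanSpace ℝ (Fin 3)), Literature.Analysis.FluidPDE.HasRapidSpatialDecay u₀ → ∀ (u v : ℝ → EuclideanSpace ℝ (Fin 3) → EuclideanSpace ℝ (Fin 3)) (p q : ℝ → EuclideanSpace ℝ (Fin 3) → ℝ) (T : ℝ), 0 < T → Literature.Analysis.FluidPDE.IsSmoothOnHalfSpace u → Literature.Analysis.FluidPDE.IsSmoothOnHalfSpace p → Literature.Analysis.FluidPDE.IsNavierStokesSolution ν 0 u₀ u p → Literature.Analysis.FluidPDE.HasBoundedEnergy u → Literature.Analysis.FluidPDE.IsClassicalNSSolutionOn (Set.Ico 0 T) ν 0 v q → Literature.Analysis.FluidPDE.IsLerayHopfOn T ν 0 u₀ v → v 0 = u₀ → ∀ t ∈ Set.Ico 0 T, u t = v t)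

/-- item stmt-NavierStokesRegularity-1534 · crux · rank 2 · open · by planner
why it might fail: Tsai's Liouville side may hold (λ≈1 removed under this very bound, ChaeWolf2017RemovingDSS Thm 1.3; SS profiles vanish, Tsai1998); and O_h puts 9 mirror planes with ω ∥ n through the singular point, exactly where antiparallel sheets annihilate — every symmetric DNS so far loses circulation there.
sources: Tsai2018, BradshawTsai2017CPDE, ChaeWolf2017RemovingDSS, BrennerHormozPumir2016, Pelz1997, Pelz2001
[crux] card (R2), the relay's stage-map fixed point in the in-tree language: there are λ > 1 and a
NONTRIVIAL ancient mild solution u of NS (ν = 1) on ℝ³×(−∞,0) with measurable slices, λ-discretely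
self-similar (nsRescale λ u = u), with a Type-I bound |u(t,x)| ≤ C₀/(|x|+√−t), and O_h-EQUIVARIANT:
u(t, g x) = g u(t, x) for all t < 0, all x and every linear isometry g permuting the signed
coordinate axes. λ = A (or A^k) is the relay's aspect ratio; one period = one stage (tube → sheet →
single spiral → tube at scale 1/A, all three pairs simultaneously); the C₀/|x| tail is the debris of
the earlier stages. Implies ¬TypeIDSSLiouvilleConjecture (support OhProfileGivesTsaiWitness, proved
in Sketch.lean) hence serves Blowup #5 / DssFarFieldSlaving H1 (stmt-0155) as their first concrete
source sector. [difficulty: open-problem] -/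
@[route_item "route-NavierStokesRegularity-CirculationRelay", crux]
def OhRelayProfileExists : Prop :=
  ∃ c : ℝ, 1 < c ∧ ∃ u : ℝ → EuclideanSpace ℝ (Fin 3) → EuclideanSpace ℝ (Fin 3), Literature.Analysis.FluidPDE.IsAncientMildSolution 1 u ∧ (∀ t < 0, MeasureTheory.AEStronglyMeasurable (u t) MeasureTheory.volume) ∧ Literature.Analysis.FluidPDE.IsDiscretelySelfSimilar c u ∧ (∃ C₀ : ℝ, Literature.Analysis.FluidPDE.HasTypeIDecay C₀ u) ∧ (∀ g : EuclideanSpace ℝ (Fin 3) ≃ₗᵢ[ℝ] EuclideanSpace ℝ (Fin 3), (∀ i : Fin 3, ∃ j : Fin 3, g (EuclideanSpace.single i 1) = EuclideanSpace.single j 1 ∨ g (EuclideanSpace.single i 1) = -EuclideanSpace.single j 1) → ∀ t < 0, ∀ x, u t (g x) = g (u t x)) ∧ ¬ (∀ t < 0, u t =ᵐ[MeasureTheory.volume] 0)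

/-- item stmt-NavierStokesRegularity-1535 · crux · rank 3 · open · by planner
why it might fail: with the symmetry modes gone, the equivariant monodromy operator of a large-C₀ orbit may still carry infinitely many unstable multipliers (essential spectrum from the L^∞ far field once C₀/(4ν) > gap ½); then only a hyperbolicity-conditional bridge survives (DssFarFieldSlaving #3).
sources: JiaSverak2014, BradshawTsai2019, ChaeWolf2018, Tsai2018, ElgindiJeong2021, stmt-NavierStokesRegularity-0901
[crux] card (R3) in symmetric form: OhRelayProfileExists → OhBlowupExists. Given the O_h profile
u_*, truncate O_h-symmetrically (Bogovskiĭ-corrected cut-off at radius R, mollified tail) to a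
Schwartz divergence-free equivariant datum; equivariance propagates by uniqueness of classical
solutions, so the singularity stays at the apex x = 0 (where u = ∇u = 0 for all t by Schur); in
Leray variables the profile is an s-periodic orbit and the tuning is a finite-codimension
stable-manifold problem for its monodromy operator restricted to the O_h-invariant isotypic
component, which contains neither the three unstable translation multipliers e^(P/2) (T₁u) nor the
three neutral rotation multipliers (T₁g): the only modulation parameter is the blow-up time. Weaker
than its unsymmetric twin DssTruncationBridge (stmt-0901, re-asked below as support) composed with
OhProfileGivesTsaiWitness EXCEPT for the equivariance of the output datum; either chain assembles
(Sketch.lean: assembly_holds, assembly2_holds). [deps: OhRelayProfileExists] [difficulty: XL] -/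
@[route_item "route-NavierStokesRegularity-CirculationRelay", crux]
def OhTruncationBridge : Prop :=
  (∃ c : ℝ, 1 < c ∧ ∃ u : ℝ → EuclideanSpace ℝ (Fin 3) → EuclideanSpace ℝ (Fin 3), Literature.Analysis.FluidPDE.IsAncientMildSolution 1 u ∧ (∀ t < 0, MeasureTheory.AEStronglyMeasurable (u t) MeasureTheory.volume) ∧ Literature.Analysis.FluidPDE.IsDiscretelySelfSimilar c u ∧ (∃ C₀ : ℝ, Literature.Analysis.FluidPDE.HasTypeIDecay C₀ u) ∧ (∀ g : EuclideanSpace ℝ (Fin 3) ≃ₗᵢ[ℝ] EuclideanSpace ℝ (Fin 3), (∀ i : Fin 3, ∃ j : Fin 3, g (EuclideanSpace.single i 1) = EuclideanSpace.single j 1 ∨ g (EuclideanSpace.single i 1) = -EuclideanSpace.single j 1) → ∀ t < 0, ∀ x, u t (g x) = g (u t x)) ∧ ¬ (∀ t < 0, u t =ᵐ[MeasureTheory.volume] 0)) → ∃ ν : ℝ, 0 < ν ∧ ∃ T : ℝ, 0 < T ∧ ∃ (u : ℝ → EuclideanSpace ℝ (Fin 3) → EuclideanSpace ℝ (Fin 3))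 (p : ℝ → EuclideanSpace ℝ (Fin 3) → ℝ), Literature.Analysis.FluidPDE.IsMaximalSmoothSolution ν 0 u p T ∧ Literature.Analysis.FluidPDE.IsLerayHopfOn T ν 0 (u 0) u ∧ Literature.Analysis.FluidPDE.HasRapidSpatialDecay (u 0) ∧ (∀ g : EuclideanSpace ℝ (Fin 3) ≃ₗᵢ[ℝ] EuclideanSpace ℝ (Fin 3), (∀ i : Fin 3, ∃ j : Fin 3, g (EuclideanSpace.single i 1) = EuclideanSpace.single j 1 ∨ g (EuclideanSpace.single i 1) = -EuclideanSpace.single j 1) → ∀ x, u 0 (g x) = g (u 0 x))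

-- item stmt-NavierStokesRegularity-1605 · crux · rank 4 · open · by planner — informal only, no Lean statement yet:
--   [crux] OneLosslessStage (card R1; the relay's computational/empirical crux, informal until one
--   validated computation fixes the norm; layer-2 child C1 of OhRelayProfileExists): there are a
--   Reynolds number Re = Γ/ν, an aspect ratio A ≥ 2 and an O_h-equivariant configuration U₀ of three
--   mutually orthogonal antiparallel tube pairs (Pelz dodecapole: circulation Γ, core δ, scale ℓ) such
--   that the renormalised stage map 𝓡 := S_A⁻¹ ∘ Φ_τ (Navier–Stokes flow for the stage time τ ≍
--   (ℓ²/Γ)·log A, then parabolic rescaling by A about the apex), acting on O_h-equivariant similarity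
--   profiles modulo the time p

/-- item stmt-NavierStokesRegularity-1536 · crux · rank 5 · open · by planner
why it might fail: it is ¬(crux 2): false exactly if the relay fixed point exists; KNSS2009 Thms 5.1–5.3 / SereginSverak2009 need a CONTINUOUS symmetry and ChaeWolf2017RemovingDSS only λ near 1, so a proof must exploit the mirror-plane structure — untested.
sources: KNSS2009, SereginSverak2009, ChaeWolf2017RemovingDSS, Tsai2018, ElgindiJeong2021, Pelz2001
[crux] the KILL SWITCH, Tsai's Type-I λ-DSS Liouville statement restricted to the O_h sector: for
every λ > 1, every O_h-equivariant ancient mild solution (ν = 1, measurable slices) that is λ-DSS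
with a Type-I bound vanishes a.e. on every slice t < 0. Logically ↔ ¬OhRelayProfileExists
(ohLiouville_iff_not_profile in Sketch.lean); filed with a rank because it is the cheap decisive
refutation of the line and a NEW sector Liouville problem with extra structure no tool on file uses:
a finite (not continuous) stabiliser, u(t,0) = 0 and ∇u(t,0) = 0 (flat apex), ω normal to each of
the 9 mirror planes, zero helicity, and on each mirror the normal vorticity obeys a conservative 2-D
advection–diffusion law — a scalar, maximum-principle-friendly reduction through the singular point.
If proved it is negative knowledge for every profile hunter (quarter-turn RDSS, dynamo cards): leave
O_h. [difficulty: open-problem] -/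
@[route_item "route-NavierStokesRegularity-CirculationRelay"]
def OhTypeIDssLiouville : Prop :=
  ∀ c : ℝ, 1 < c → ∀ u : ℝ → EuclideanSpace ℝ (Fin 3) → EuclideanSpace ℝ (Fin 3), Literature.Analysis.FluidPDE.IsAncientMildSolution 1 u → (∀ t < 0, MeasureTheory.AEStronglyMeasurable (u t) MeasureTheory.volume) → Literature.Analysis.FluidPDE.IsDiscretelySelfSimilar c u → (∃ C₀ : ℝ, Literature.Analysis.FluidPDE.HasTypeIDecay C₀ u) → (∀ g : EuclideanSpace ℝ (Fin 3) ≃ₗᵢ[ℝ] EuclideanSpace ℝ (Fin 3), (∀ i : Fin 3, ∃ j : Fin 3, g (EuclideanSpace.single i 1) = EuclideanSpace.single j 1 ∨ g (EuclideanSpace.single i 1) = -EuclideanSpace.single j 1) → ∀ t < 0, ∀ x, u t (g x) = g (u t x)) → ∀ t < 0, u t =ᵐ[MeasureTheory.volume] 0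

/-- item stmt-NavierStokesRegularity-0153 · support · rank 9 · closed · proved by Summit.NavierStokesRegularity.NavierStokesRegularity.Theorems.adiabaticEddy_clayUniqueness_proof @ bd26efe366a2 (prover) · by planner
sources: Tao2011, Fefferman2000
Fefferman's class (A) = jointly C^∞ on ℝ³×[0,∞) + sup_t ∫|u|² < ∞; no energy inequality, no decay of
∇u, no integrability in LPS scales is assumed. Claim: such (u,p) coincides on [0,T) with any
Leray–Hopf classical solution v from the same rapidly decaying datum. Expected route: smoothness +
bounded energy ⇒ u is a distributional solution with locally finite dissipation?? (NOT automatic: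
∫∫|∇u|² may be infinite) — this is exactly the delicate point; alternatives: Liouville-type control
of the pressure (p harmonic part must be affine ⇒ excluded by bounded energy), then local energy
inequality, then weak–strong uniqueness (Prodi 1959, Serrin 1963) against v which is in every LPS
class on compacts of [0,T). [sources: Prodi1959, Serrin1963, Fefferman2000, LemarieRieusset2002,
RobinsonRodrigoSadowski2016] -/
@[route_item "route-NavierStokesRegularity-CirculationRelay", crux]
def ClayUniqueness : Prop :=
  ∀ ν : ℝ, 0 < ν → ∀ (u₀ : EuclideanSpace ℝ (Fin 3) → EuclideanSpace ℝ (Fin 3)), Literature.Analysis.FluidPDE.HasRapidSpatialDecay u₀ → ∀ (u v : ℝ → EuclideanSpace ℝ (Fin 3) → EuclideanSpace ℝ (Fin 3)) (p q : ℝ → EuclideanSpace ℝ (Fin 3) → ℝ) (T : ℝ), 0 < T → Literature.Analysis.FluidPDE.IsSmoothOnHalfSpace u → Literature.Analysis.FluidPDE.IsSmoothOnHalfSpace p → Literature.Analysis.FluidPDE.IsNavierStokesSolution ν 0 u₀ u p → Literature.Analysis.FluidPDE.HasBoundedEnergy u → Literature.Analysis.FluidPDE.IsClassicalNSSolutionOn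 (Set.Ico 0 T) ν 0 v q → Literature.Analysis.FluidPDE.IsLerayHopfOn T ν 0 u₀ v → v 0 = u₀ → ∀ t ∈ Set.Ico 0 T, u t = v t

/-- `ClayUniqueness` holds: proved by `Summit.NavierStokesRegularity.NavierStokesRegularity.Theorems.adiabaticEddy_clayUniqueness_proof` @ bd26efe366a2. -/
theorem ClayUniqueness_holds : ClayUniqueness := _root_.Summit.NavierStokesRegularity.NavierStokesRegularity.Theorems.adiabaticEddy_clayUniqueness_proof

/-- item stmt-NavierStokesRegularity-1538 · support · rank 9 · closed · proved by Summit.NavierStokesRegularity.NavierStokesRegularity.Theorems.circulationFloor_proof @ 3515dba5fe05 (prover) · by planner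
sources: CheskidovShvydkoy2010, GigaMiyakawa1989, BrennerHormozPumir2016, MckeownEtAl2020
[support] card (R4), the KELVIN-BATTERY FLOOR in loop language, provable now: there is an absolute
c₀ > 0 such that if a finite-energy classical solution from a rapidly decaying datum on [0,T) has no
smooth extension past T, then for every δ > 0 some slice t < T and some planar circle of radius r ≤
δ (centre c, orthonormal frame e₁,e₂) carry circulation |∮ u(t)·dl| ≥ c₀ν. Proof route
(contrapositive): circle circulation = disc flux of ω (Stokes, u(t) smooth); slicing a ball by
planes ⊥ n gives |∫_(B_ρ(x)) ω·n| ≤ 2ρ·c₀ν for ρ ≤ δ, all x, n, t; the heat-kernel (radially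
decreasing kernel = superposition of balls; the ρ > δ part is bounded by the energy through ∫_(B_ρ)
ω·n = ∮_(∂B_ρ)(ν_out×u)·n and dies super-exponentially) characterisation of negative Besov norms
gives sup_t ‖Δ_q ω(t)‖_∞ ≲ c₀ν 2^(2q), Biot–Savart sup_t 2^(−q)‖Δ_q u(t)‖_∞ ≲ C c₀ν for large q, so
for c₀ small the in-tree PROVED criterion cheskidov_shvydkoy_dyadic_holds (CheskidovShvydkoy2010
Lemma 3.2) yields a classical representative on (0,T], and the in-tree local theory
(leray_local_regular_H1_holds / leray_continuation_H1_holds) extends past T. Consequences used by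
the line: every relay stage and the profile of cr -/
@[route_item "route-NavierStokesRegularity-CirculationRelay"]
def CirculationFloor : Prop :=
  ∃ c₀ : ℝ, 0 < c₀ ∧ ∀ (ν T : ℝ), 0 < ν → 0 < T → ∀ (u : ℝ → EuclideanSpace ℝ (Fin 3) → EuclideanSpace ℝ (Fin 3)) (p : ℝ → EuclideanSpace ℝ (Fin 3) → ℝ), Literature.Analysis.FluidPDE.IsClassicalNSSolutionOn (Set.Ico 0 T) ν 0 u p → Literature.Analysis.FluidPDE.IsLerayHopfOn T ν 0 (u 0) u → Literature.Analysis.FluidPDE.HasRapidSpatialDecay (u 0) → ¬ Literature.Analysis.FluidPDE.HasSmoothExtensionPast ν 0 u T → ∀ δ : ℝ, 0 < δ → ∃ t ∈ Set.Ico 0 T, ∃ (c e₁ e₂ : EuclideanSpace ℝ (Fin 3)) (r : ℝ), 0 < r ∧ r ≤ δ ∧ ‖e₁‖ = 1 ∧ ‖e₂‖ = 1 ∧ inner ℝ e₁ e₂ = 0 ∧ c₀ * ν ≤ |∫ θ in (0 : ℝ)..(2 * Real.pi), inner ℝ (u t (c + (r * Real.cos θ) • e₁ + (r * Real.sin θ)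 • e₂)) ((-(r * Real.sin θ)) • e₁ + (r * Real.cos θ) • e₂)|

-- `CirculationFloor` holds: proved by `Summit.NavierStokesRegularity.NavierStokesRegularity.Theorems.circulationFloor_proof` @ 3515dba5fe05 (its module imports this route file, so no `_holds` link can be stated here).

/-- item stmt-NavierStokesRegularity-1539 · assembly · rank 1 · closed · proved by Summit.NavierStokesRegularity.NavierStokesRegularity.Theorems.circulationRelay_assembly_proof (prover) · by planner
sources: Fefferman2000, Tsai2018
[assembly] OhRelayProfileExists → OhTruncationBridge → ClayUniqueness → ¬NavierStokesRegularity
(negative side: the summit constant appears negated, as in route Blowup). -/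
@[route_item "route-NavierStokesRegularity-CirculationRelay"]
def Assembly : Prop :=
  (∃ c : ℝ, 1 < c ∧ ∃ u : ℝ → EuclideanSpace ℝ (Fin 3) → EuclideanSpace ℝ (Fin 3), Literature.Analysis.FluidPDE.IsAncientMildSolution 1 u ∧ (∀ t < 0, MeasureTheory.AEStronglyMeasurable (u t) MeasureTheory.volume) ∧ Literature.Analysis.FluidPDE.IsDiscretelySelfSimilar c u ∧ (∃ C₀ : ℝ, Literature.Analysis.FluidPDE.HasTypeIDecay C₀ u) ∧ (∀ g : EuclideanSpace ℝ (Fin 3) ≃ₗᵢ[ℝ] EuclideanSpace ℝ (Fin 3), (∀ i : Fin 3, ∃ j : Fin 3, g (EuclideanSpace.single i 1) = EuclideanSpace.single j 1 ∨ g (EuclideanSpace.single i 1) = -EuclideanSpace.single j 1) → ∀ t < 0, ∀ x, u t (g x) = g (u t x)) ∧ ¬ (∀ t < 0, u t =ᵐ[MeasureTheory.volume] 0)) → ((∃ c : ℝ, 1 < c ∧ ∃ u : ℝ → EuclideanSpace ℝ (Fin 3) → EuclideanSpace ℝ (Fin 3), Literature.Analysis.FluidPDE.IsAncientMildSolution 1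 u ∧ (∀ t < 0, MeasureTheory.AEStronglyMeasurable (u t) MeasureTheory.volume) ∧ Literature.Analysis.FluidPDE.IsDiscretelySelfSimilar c u ∧ (∃ C₀ : ℝ, Literature.Analysis.FluidPDE.HasTypeIDecay C₀ u) ∧ (∀ g : EuclideanSpace ℝ (Fin 3) ≃ₗᵢ[ℝ] EuclideanSpace ℝ (Fin 3), (∀ i : Fin 3, ∃ j : Fin 3, g (EuclideanSpace.single i 1) = EuclideanSpace.single j 1 ∨ g (EuclideanSpace.single i 1) = -EuclideanSpace.single j 1) → ∀ t < 0, ∀ x, u t (g x) = g (u t x)) ∧ ¬ (∀ t < 0, u t =ᵐ[MeasureTheory.volume] 0)) → ∃ ν : ℝ, 0 < ν ∧ ∃ T : ℝ, 0 < T ∧ ∃ (u : ℝ → EuclideanSpace ℝ (Fin 3) → EuclideanSpace ℝ (Fin 3)) (p : ℝ → EuclideanSpace ℝ (Fin 3) → ℝ), Literature.Analysis.FluidPDE.IsMaximalSmoothSolution ν 0 u p T ∧ Literature.Analysis.FluidPDE.IsLerayHopfOn T ν 0 (u 0) u ∧ Literature.Analysis.FluidPDE.HasRapidSpatialDecay (u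 0) ∧ (∀ g : EuclideanSpace ℝ (Fin 3) ≃ₗᵢ[ℝ] EuclideanSpace ℝ (Fin 3), (∀ i : Fin 3, ∃ j : Fin 3, g (EuclideanSpace.single i 1) = EuclideanSpace.single j 1 ∨ g (EuclideanSpace.single i 1) = -EuclideanSpace.single j 1) → ∀ x, u 0 (g x) = g (u 0 x))) → (∀ ν : ℝ, 0 < ν → ∀ (u₀ : EuclideanSpace ℝ (Fin 3) → EuclideanSpace ℝ (Fin 3)), Literature.Analysis.FluidPDE.HasRapidSpatialDecay u₀ → ∀ (u v : ℝ → EuclideanSpace ℝ (Fin 3) → EuclideanSpace ℝ (Fin 3)) (p q : ℝ → EuclideanSpace ℝ (Fin 3) → ℝ) (T : ℝ), 0 < T → Literature.Analysis.FluidPDE.IsSmoothOnHalfSpace u → Literature.Analysis.FluidPDE.IsSmoothOnHalfSpace p → Literature.Analysis.FluidPDE.IsNavierStokesSolution ν 0 u₀ u p → Literature.Analysis.FluidPDE.HasBoundedEnergy u → Literature.Analysis.FluidPDE.IsClassicalNSSolutionOn (Set.Ico 0 T) ν 0 v q → Literature.Analysis.FluidPDE.IsLerayHopfOn T ν 0 u₀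 v → v 0 = u₀ → ∀ t ∈ Set.Ico 0 T, u t = v t) → ¬ NavierStokesRegularity

-- `Assembly` holds: proved by `Summit.NavierStokesRegularity.NavierStokesRegularity.Theorems.circulationRelay_assembly_proof` (its module imports this route file, so no `_holds` link can be stated here).

/-! D-0027 §2.1 — DECIDING THEOREM (planner-authored via `route open/edit --closes-file`; by planner-rbadge-NavierStokesRegularity-Circulat-6a16d06a-g2-0 2026-08-15T16:20:06Z):
its hypotheses are this route's items and its conclusion the sub-problem Statement (glue_lint), and it elaborates with this file. -/

@[closes "route-NavierStokesRegularity-CirculationRelay"] theorem closes (hProfile : OhRelayProfileExists) (hBridge : OhTruncationBridge)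
    (hUniq : ClayUniqueness) : ¬ _root_.NavierStokesRegularity := by
  -- the O_h profile, truncated O_h-symmetrically, is a maximal smooth Leray–Hopf solution
  -- from a rapidly decaying datum with finite lifespan `T` (drop the equivariance clause = X5a)
  obtain ⟨ν, hν, T, hT, u, p, ⟨hcl, hmax⟩, hLH, hdec, _hsym⟩ := hBridge hProfile
  intro hA
  have h0 : (0 : ℝ) ∈ Set.Ico 0 T := ⟨le_rfl, hT⟩
  -- Clay (A) applied to the datum `u 0` gives a global smooth bounded-energy solution
  obtain ⟨u', p', hu', hp', hns, hbe⟩ :=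
    hA ν hν (u 0) (hcl.contDiff_velocity h0) (hcl.divFree 0 h0) hdec
  -- X5b glues it to the blowing-up solution on `[0, T)`
  have heq : ∀ t ∈ Set.Ico 0 T, u' t = u t :=
    hUniq ν hν (u 0) hdec u' u p' p T hT hu' hp' hns hbe hcl hLH rfl
  -- wave-0 Clay solution + joint smoothness = classical solution on `Ici 0` (fieldwise)
  have hcl' : Literature.Analysis.FluidPDE.IsClassicalNSSolutionOn (Set.Ici 0) ν 0 u' p' :=
    ⟨hu', hp', fun t ht x => hns.momentum t ht x, fun t ht => hns.divFree t ht⟩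
  -- its restriction to `[0, T + 1)` extends `u` smoothly past `T`: contradiction with maximality
  refine hmax ⟨T + 1, by linarith, u', p', ?_, heq⟩
  exact hcl'.mono (fun t ht => ht.1) (uniqueDiffOn_Ico 0 (T + 1))

end Summit.NavierStokesRegularity.NavierStokesRegularity.Theses.CirculationRelay
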